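import Literature.Probability.FitznerVanDerHofstad2017.LaceBootstrap
import Literature.Probability.FitznerVanDerHofstad2017.MeanFieldD11
import Literature.Probability.FitznerVanDerHofstad2017.MeanFieldOfTriangle
import HarnessLib

/-!
# The rung theorem with the full mean-field conclusion:
# `LaceBootstrapHypotheses d K → AnalyticLeaves d K → MeanField d`

Topic `Literature/Probability/FitznerVanDerHofstad2017`, family `crit-perc` (cell `b2b-lace`,
literature seat). Bookkeeping corollaries only: the rung theorem
`percolationContinuity_of_laceBootstrap` (`LaceBootstrap.lean`) and the `d = 11` / `d = 10`
certificate theorems (`MeanFieldD11.lean`) conclude `TriangleCondition d ∧ θ(p_c) = 0 (∧ β = 1)`; with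
`meanField_of_triangle` (`MeanFieldOfTriangle.lean`: the triangle condition gives `γ = β = 1`,
`δ = 2` in the bounded-ratio sense and `θ(p_c) = 0`, every `d ≥ 2`) they conclude the full
statement of Fitzner–van der Hofstad 2017, Cor. 1.3 — `MeanField d` (`MeanFieldExponents.lean`).
No new hypotheses, definitions or facts.

## References

* R. Fitzner, R. van der Hofstad, Electron. J. Probab. 22 (2017) no. 43: Cor. 1.3 (EJP p. 6).
  [FitznerVanDerHofstad2017]
* M. Heydenreich, R. van der Hofstad, Springer 2017: Thm. 4.1, Thm. 9.2. [HeydenreichVanDerHofstad2017]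
-/

noncomputable section

namespace Literature.Probability.FitznerVanDerHofstad2017

open Literature.Probability.LatticeModels Literature.Probability.Percolation
open Literature.Barriers.CriticalPhenomena

/-- **The rung theorem, mean-field form**: explicitly stated bootstrap hypotheses (with their numeric
certificate) and the analytic leaves give FULL mean-field behaviour in dimension `d`:
`θ(p_c) = 0 ∧ γ = 1 ∧ β = 1 ∧ δ = 2` (bounded-ratio sense).
[cite: FitznerVanDerHofstad2017, Cor. 1.3, EJP p. 6] [cite: HeydenreichVanDerHofstad2017, Thm. 4.1] -/
theorem meanField_of_laceBootstrap (d : ℕ) (K : BootstrapConstants) :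
    LaceBootstrapHypotheses d K → AnalyticLeaves d K → MeanField d := by
  intro hN hA
  have hd : 2 ≤ d := le_trans (by norm_num) hN.1
  exact meanField_of_triangle hd (percolationContinuity_of_laceBootstrap d K hN hA).1

/-- **`d = 11`, mean-field form**: from the `d = 11` certificate hypotheses of `MeanFieldD11.lean`
(same status as `D11.meanField_d11`: CONDITIONAL on the numeric inputs `hN`, `hI`, `hS`),
`MeanField 11`. [cite: FitznerVanDerHofstad2017, Cor. 1.3, Thm. 1.2 (row d = 11)] -/
theorem D11.meanField_d11_full {γ : Fin 3 → ℝ} {c : Fin 6 → ℝ} {Bi Bo : NobleBeta} {bi bo : Fin 6 → ℝ}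
    (hN : NobleNumericCertificate 11 D11.cMu c γ D11.Gamma Bi Bo bi bo)
    (hI : NobleInitialInputsAt 11 Bi bi)
    (hS : NobleImprovementInputsAt 11 D11.cMu c D11.Gamma Bo bo) : MeanField 11 :=
  meanField_of_triangle (by norm_num) (D11.meanField_d11 hN hI hS).1

/-- **`d = 10` slot, mean-field form**: any numeric certificate at `d = 10` gives `MeanField 10`.
[cite: FitznerVanDerHofstad2017, §2.7] -/
theorem meanField_d10_full {cμ : ℝ} {c : Fin 6 → ℝ} {γ Γ : Fin 3 → ℝ} {Bi Bo : NobleBeta}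
    {bi bo : Fin 6 → ℝ}
    (hN : NobleNumericCertificate 10 cμ c γ Γ Bi Bo bi bo) (hI : NobleInitialInputsAt 10 Bi bi)
    (hS : NobleImprovementInputsAt 10 cμ c Γ Bo bo) : MeanField 10 :=
  meanField_of_triangle (by norm_num) (meanField_d10 hN hI hS).1

end Literature.Probability.FitznerVanDerHofstad2017

end
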